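import Summits.QuantumFields.YangMills.Theorems.AllWindowsColdBoxBoxHighLinePlaqCostSizesOnD
import Summits.QuantumFields.YangMills.Theorems.AllWindowsColdBoxBoxHighLinePlaqCostMomentsOnD
import Summits.QuantumFields.YangMills.Theorems.AllWindowsColdBoxBoxHighLineTiltCum3Split

/-!
# T-S5.13K-K4, preliminaries — the `U`-slot of the fourth tilted cumulant and the (e5) bookkeeping arithmetic
# (ASSEMBLY-S5 §6 (e5); LEAD sfw-p2 g77's ε₂-memo STEP 3; LINE-19 S5 ⟨stmt-QuantumFields-24004⟩/⟨24335⟩, LINE-20 U5 ⟨24336⟩)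

Width seat `ym-line-sfw-p2-w5` (prover-ym-line-sfw-p2-w5-g23-0).  Inputs of ✓`…TiltCum4Bound` (`GaussNormalForm.abs_tiltCum4_muD_le_of_sizes`):

* pure real arithmetic kept OUT of the main proof (so that `linarith` sees a small context): `div_le_two_mul_of_half_le`
  (`E₀[1_D·Y]/E₀[1_D] ≤ 2E₀[1_D·Y]` when `E₀[1_D] ≥ 1/2`), `sqrt_mul_sqrt_add_eq` (collapse of w5 g22's ✓`Tilt.abs_tiltCum4_le_of_moments` for
  equal sizes), ★`k4_bookkeeping` (`4p + 15·m·mU ≤ C·e⁴·(1+log H)^m·(H⁴/β³ + s⁶H⁴/β + (s²+1/β)²·RU)` from the three slot bounds),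
  `k4_combine`;
* the indicator truncation `Ũ = 1_D·tiltU`: `sfInd_mul_indicator_eq`, `integral_sfInd_mul_gaussWeight_pos` (with w4's ✓`TiltSup.sfInd_nonneg_le_one`,
  LEAD's ✓`Tilt.measurable_sfInd`);
* integrability against the Hodge Gaussian (private `k4_abs_cubicVertex_le`, `k4_integrable_cubicVertex_sq` — fcl-p3's ✓`…TiltUParitySizes` has public copies),
  `integrable_sfInd_mul_sq_add_cubicVertex`;
* ★ the `U`-slot `gaussAvg_sfInd_mul_sq_indicator_sub_le`: `E₀[1_D(Ũ − b)²] ≤ 2E₀[V₃²] + 2E₀[1_D(tiltU + V₃ − b)²]` — the last term is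
  fcl-p3's 13K-U quantity, the first is ✓12a `cubicVariance`.

Everything proved; no definitions; standard axioms.  HONEST LABEL: support lemmas for the OPEN assembly T-S5.13 of the XL stub S5 of a
critic-PASSed DRAFT line; S5, U5, ⟨24004⟩ ⟨24335⟩ ⟨24336⟩ remain OPEN; no crux, rung or summit is proved; **the Yang–Mills mass gap is NOT
proved by this file; no summit is proved by a line.**
-/

set_option autoImplicit false

noncomputable section

open MeasureTheory Set Real
open Literature.Probability.LatticeModels (Site)
open Summit.QuantumFields.YangMills.Theorems.WeakCouplingRates (plaq12At)

namespace Summit.QuantumFields.YangMills.Theorems.AllWindowsColdBoxBoxHighLine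

namespace GaussNormalForm

variable {H : ℕ}

/-! ## Small real-arithmetic helpers (kept outside the main proof so that `nlinarith` sees a small context) -/

/-- `X/d ≤ 2X` for `X ≥ 0`, `d ≥ 1/2`. -/
theorem div_le_two_mul_of_half_le {X d : ℝ} (hX : 0 ≤ X) (hd : 1 / 2 ≤ d) : X / d ≤ 2 * X := by
  have hd0 : 0 < d := by linarith
  rw [div_le_iff₀ hd0]
  nlinarith

/-- `√X·√X = X`-type collapse of the abstract `κ₄` bound when the two observables have the same sizes. -/
theorem sqrt_mul_sqrt_add_eq {P M MU : ℝ} (hP : 0 ≤ P) (hM : 0 ≤ M) (hMU : 0 ≤ MU) :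
    Real.sqrt (4 * P + 12 * (M * MU)) * Real.sqrt (4 * P + 12 * (M * MU)) + 3 * (Real.sqrt M * Real.sqrt M) * MU =
      4 * P + 15 * (M * MU) := by
  rw [Real.mul_self_sqrt (by positivity), Real.mul_self_sqrt hM]
  ring

/-- `(u + v − b)² ≤ 2(u − b)² + 2v²`. -/
theorem sq_add_sub_le_two (u v b : ℝ) : (u + v - b) ^ 2 ≤ 2 * (u - b) ^ 2 + 2 * v ^ 2 := by
  nlinarith [sq_nonneg (u - b - v)]

/-- `(u − b)² ≤ 2v² + 2(u + v − b)²`. -/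
theorem sq_sub_le_two (u v b : ℝ) : (u - b) ^ 2 ≤ 2 * v ^ 2 + 2 * (u + v - b) ^ 2 := by
  nlinarith [sq_nonneg (u + v - b + v)]

/-- `(x − r)² ≤ (B + |r|)²` when `|x| ≤ B`. -/
theorem sq_sub_le_sq_add_abs {x B : ℝ} (hx : |x| ≤ B) (r : ℝ) : |(x - r) ^ 2| ≤ (B + |r|) ^ 2 := by
  rw [abs_pow]
  exact pow_le_pow_left₀ (abs_nonneg _) ((abs_sub _ _).trans (add_le_add hx le_rfl)) 2

/-- **The final bookkeeping of (e5)**: with the three slots `p ≤ E₂·2·(C₃·L^{m₃}·(A₁ + B) + 2K²·RU)`,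
`m ≤ E₂·2·(C_G·L²·ι²)`, `mU ≤ E₂·2·(2·C₁₂·X·L^{m₁₂} + 2·RU)` (`ι = 1/β`, `X = H⁴/β`, `A₁ = H⁴/β³ = X·ι²`, `B = s⁶H⁴/β`,
`0 ≤ K ≤ 116(s² + ι)`), one has `4p + 15·m·mU ≤ C·E₂²·L^{m₃+m₁₂+2}·(A₁ + B + (s² + ι)²·RU)`. -/
theorem k4_bookkeeping {E₂ C_G C_3 C₁₂ L A₁ B X ι s2 K RU p m mU : ℝ} {m_3 m₁₂ : ℕ} (hE₂ : 1 ≤ E₂) (hC_G : 0 ≤ C_G)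
    (hC_3 : 0 ≤ C_3) (hC₁₂ : 0 ≤ C₁₂) (hL : 1 ≤ L) (hA₁ : 0 ≤ A₁) (hB : 0 ≤ B) (hι : 0 ≤ ι) (hXA : X * ι ^ 2 = A₁)
    (hs2 : 0 ≤ s2) (hK0 : 0 ≤ K) (hK : K ≤ 116 * (s2 + ι)) (hRU : 0 ≤ RU) (hmU0 : 0 ≤ mU)
    (hp : p ≤ E₂ * (2 * (C_3 * L ^ m_3 * (A₁ + B) + 2 * K ^ 2 * RU))) (hm : m ≤ E₂ * (2 * (C_G * L ^ 2 * ι ^ 2)))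
    (hmU : mU ≤ E₂ * (2 * (2 * (C₁₂ * X * L ^ m₁₂) + 2 * RU))) :
    4 * p + 15 * (m * mU) ≤ (64 * C_3 + 7680 * C_G * C₁₂ + 1722368 + 7680 * C_G) * E₂ ^ 2 * L ^ (m_3 + m₁₂ + 2) *
      (A₁ + B + (s2 + ι) ^ 2 * RU) := by
  set Lm := L ^ (m_3 + m₁₂ + 2) with hLm
  have hL3 : L ^ m_3 ≤ Lm := pow_le_pow_right₀ hL (by omega)
  have hL12 : L ^ 2 * L ^ m₁₂ ≤ Lm := by rw [← pow_add]; exact pow_le_pow_right₀ hL (by omega)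
  have hL2 : L ^ 2 ≤ Lm := pow_le_pow_right₀ hL (by omega)
  have hLm1 : 1 ≤ Lm := one_le_pow₀ hL
  have hL30 : 0 ≤ L ^ m_3 := by positivity
  have hL20 : 0 ≤ L ^ 2 := by positivity
  have hL120 : 0 ≤ L ^ m₁₂ := by positivity
  have hq0 : 0 ≤ (s2 + ι) ^ 2 := sq_nonneg _
  have hAB : 0 ≤ A₁ + B := add_nonneg hA₁ hB
  have hK2 : K ^ 2 ≤ 13456 * (s2 + ι) ^ 2 :=
    calc K ^ 2 = K * K := sq K
      _ ≤ (116 * (s2 + ι)) * (116 * (s2 + ι)) := mul_le_mul hK hK hK0 (hK0.trans hK)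
      _ = 13456 * (s2 + ι) ^ 2 := by ring
  have hι2 : ι ^ 2 ≤ (s2 + ι) ^ 2 := pow_le_pow_left₀ hι (by linarith) 2
  have hE₂0 : 0 ≤ E₂ := zero_le_one.trans hE₂
  have hE₂sq : 0 ≤ E₂ ^ 2 := pow_nonneg hE₂0 2
  have hE₂2 : E₂ ≤ E₂ ^ 2 := by
    have := mul_le_mul_of_nonneg_left hE₂ hE₂0
    calc E₂ = E₂ * 1 := (mul_one _).symm
      _ ≤ E₂ * E₂ := this
      _ = E₂ ^ 2 := (sq E₂).symm
  have hLm0 : 0 ≤ Lm := zero_le_one.trans hLm1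
  -- the product `m·mU`
  have hmmU : m * mU ≤ (E₂ * (2 * (C_G * L ^ 2 * ι ^ 2))) * (E₂ * (2 * (2 * (C₁₂ * X * L ^ m₁₂) + 2 * RU))) :=
    mul_le_mul hm hmU hmU0 (mul_nonneg hE₂0 (mul_nonneg zero_le_two (mul_nonneg (mul_nonneg hC_G hL20) (sq_nonneg ι))))
  -- expand and bound the four monomials
  have t1 : E₂ * (C_3 * L ^ m_3 * (A₁ + B)) ≤ E₂ ^ 2 * C_3 * Lm * (A₁ + B) := by
    have h1 : C_3 * L ^ m_3 * (A₁ + B) ≤ C_3 * Lm * (A₁ + B) :=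
      mul_le_mul_of_nonneg_right (mul_le_mul_of_nonneg_left hL3 hC_3) hAB
    calc E₂ * (C_3 * L ^ m_3 * (A₁ + B)) ≤ E₂ ^ 2 * (C_3 * Lm * (A₁ + B)) :=
          mul_le_mul hE₂2 h1 (mul_nonneg (mul_nonneg hC_3 hL30) hAB) hE₂sq
      _ = _ := by ring
  have t2 : E₂ * (K ^ 2 * RU) ≤ E₂ ^ 2 * Lm * (13456 * ((s2 + ι) ^ 2 * RU)) := by
    have h1 : K ^ 2 * RU ≤ 13456 * ((s2 + ι) ^ 2 * RU) :=
      calc K ^ 2 * RU ≤ 13456 * (s2 + ι) ^ 2 * RU := mul_le_mul_of_nonneg_right hK2 hRU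
        _ = _ := by ring
    have h2 : E₂ ≤ E₂ ^ 2 * Lm :=
      calc E₂ ≤ E₂ ^ 2 := hE₂2
        _ = E₂ ^ 2 * 1 := (mul_one _).symm
        _ ≤ E₂ ^ 2 * Lm := mul_le_mul_of_nonneg_left hLm1 hE₂sq
    exact mul_le_mul h2 h1 (mul_nonneg (sq_nonneg K) hRU) (mul_nonneg hE₂sq hLm0)
  have t3 : E₂ ^ 2 * (C_G * C₁₂) * ((L ^ 2 * L ^ m₁₂) * (X * ι ^ 2)) ≤ E₂ ^ 2 * (C_G * C₁₂) * (Lm * A₁) := by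
    rw [hXA]
    exact mul_le_mul_of_nonneg_left (mul_le_mul_of_nonneg_right hL12 hA₁) (mul_nonneg hE₂sq (mul_nonneg hC_G hC₁₂))
  have t4 : E₂ ^ 2 * C_G * ((L ^ 2 * ι ^ 2) * RU) ≤ E₂ ^ 2 * C_G * (Lm * ((s2 + ι) ^ 2 * RU)) := by
    refine mul_le_mul_of_nonneg_left ?_ (mul_nonneg hE₂sq hC_G)
    have h1 := mul_le_mul hL2 hι2 (sq_nonneg ι) hLm0
    calc L ^ 2 * ι ^ 2 * RU ≤ Lm * (s2 + ι) ^ 2 * RU := mul_le_mul_of_nonneg_right h1 hRU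
      _ = _ := by ring
  -- assemble
  have e : 4 * (E₂ * (2 * (C_3 * L ^ m_3 * (A₁ + B) + 2 * K ^ 2 * RU))) +
      15 * ((E₂ * (2 * (C_G * L ^ 2 * ι ^ 2))) * (E₂ * (2 * (2 * (C₁₂ * X * L ^ m₁₂) + 2 * RU)))) =
      8 * (E₂ * (C_3 * L ^ m_3 * (A₁ + B))) + 16 * (E₂ * (K ^ 2 * RU)) +
      120 * (E₂ ^ 2 * (C_G * C₁₂) * ((L ^ 2 * L ^ m₁₂) * (X * ι ^ 2))) + 120 * (E₂ ^ 2 * C_G * ((L ^ 2 * ι ^ 2) * RU)) := by ring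
  have hmain : 4 * p + 15 * (m * mU) ≤ 8 * (E₂ ^ 2 * C_3 * Lm * (A₁ + B)) + 16 * (E₂ ^ 2 * Lm * (13456 * ((s2 + ι) ^ 2 * RU))) +
      120 * (E₂ ^ 2 * (C_G * C₁₂) * (Lm * A₁)) + 120 * (E₂ ^ 2 * C_G * (Lm * ((s2 + ι) ^ 2 * RU))) := by
    have h4 : 4 * p ≤ 4 * (E₂ * (2 * (C_3 * L ^ m_3 * (A₁ + B) + 2 * K ^ 2 * RU))) := by linarith
    have h15 : 15 * (m * mU) ≤ 15 * ((E₂ * (2 * (C_G * L ^ 2 * ι ^ 2))) * (E₂ * (2 * (2 * (C₁₂ * X * L ^ m₁₂) + 2 * RU)))) := by linarith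
    linarith [h4, h15, e, t1, t2, t3, t4]
  refine hmain.trans ?_
  have n1 : 0 ≤ E₂ ^ 2 * Lm := mul_nonneg hE₂sq hLm0
  have nA : 0 ≤ E₂ ^ 2 * Lm * A₁ := mul_nonneg n1 hA₁
  have nB : 0 ≤ E₂ ^ 2 * Lm * B := mul_nonneg n1 hB
  have nQ : 0 ≤ E₂ ^ 2 * Lm * ((s2 + ι) ^ 2 * RU) := mul_nonneg n1 (mul_nonneg hq0 hRU)
  linarith [mul_nonneg hC_3 nA, mul_nonneg hC_3 nB, mul_nonneg hC_3 nQ, mul_nonneg hC_G nA, mul_nonneg hC_G nB, mul_nonneg hC_G nQ,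
    mul_nonneg (mul_nonneg hC_G hC₁₂) nA, mul_nonneg (mul_nonneg hC_G hC₁₂) nB, mul_nonneg (mul_nonneg hC_G hC₁₂) nQ, nA, nB, nQ]

/-! ## The indicator truncation of the tilt exponent -/

/-- On `smallField H s` the truncation `1_D·tiltU` agrees with `tiltU`, so `sfInd·F(Ũ) = sfInd·F(tiltU)` pointwise. -/
theorem sfInd_mul_indicator_eq (β s : ℝ) (F : ℝ → ℝ) (a : LandauFree H → E3) :
    sfInd H s a * F ((smallField H s).indicator (tiltU β H) a) = sfInd H s a * F (tiltU β H a) := by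
  by_cases ha : a ∈ smallField H s
  · rw [Set.indicator_of_mem ha]
  · rw [sfInd, Set.indicator_of_notMem ha, zero_mul, zero_mul]

/-- `0 < ∫ sfInd·gaussWeight` from `E₀[1_D] ≥ 1/2`. -/
theorem integral_sfInd_mul_gaussWeight_pos {β : ℝ} (hβ : 0 < β) {s : ℝ} (hD : 1 / 2 ≤ gaussAvg β H (sfInd H s)) :
    0 < ∫ a, sfInd H s a * gaussWeight β H a := by
  have hZ := EdgeChartGaussian.integral_gaussWeight_pos H hβ
  have h : gaussAvg β H (sfInd H s) = (∫ a, sfInd H s a * gaussWeight β H a) / ∫ a, gaussWeight β H a := rfl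
  rw [h, le_div_iff₀ hZ] at hD
  linarith

/-- A crude everywhere bound on the cubic vertex: `|V₃(a)| ≤ 4|β|·#{plaquettes touching the box}`. -/
private theorem k4_abs_cubicVertex_le (β : ℝ) (H : ℕ) (a : LandauFree H → E3) :
    |cubicVertex β H a| ≤ 4 * |β| * (Literature.MathematicalPhysics.QuantumLattice.plaquettesTouching
        (Literature.MathematicalPhysics.QuantumFieldTheory.AxialGauge.boxEdges 4 (2 * H + 1))).card := by
  rw [cubicVertex, abs_mul]
  have h := Finset.abs_sum_le_sum_abs (fun p : Literature.MathematicalPhysics.QuantumLattice.ZdPlaquette 4 =>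
    chartPlaqCostOdd H p.1 p.2.1.1 p.2.1.2 a)
    (Literature.MathematicalPhysics.QuantumLattice.plaquettesTouching
      (Literature.MathematicalPhysics.QuantumFieldTheory.AxialGauge.boxEdges 4 (2 * H + 1)))
  have h' := h.trans (Finset.sum_le_sum fun p _ => EdgeChartGaussian.abs_chartPlaqCostOdd_le H p.1 p.2.1.1 p.2.1.2 a)
  rw [Finset.sum_const, nsmul_eq_mul] at h'
  calc |β| * |∑ p ∈ Literature.MathematicalPhysics.QuantumLattice.plaquettesTouching
        (Literature.MathematicalPhysics.QuantumFieldTheory.AxialGauge.boxEdges 4 (2 * H + 1)), chartPlaqCostOdd H p.1 p.2.1.1 p.2.1.2 a|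
      ≤ |β| * (_ * 4) := mul_le_mul_of_nonneg_left h' (abs_nonneg _)
    _ = _ := by ring

/-- `V₃²·gaussWeight` is integrable (`β > 0`). -/
private theorem k4_integrable_cubicVertex_sq (H : ℕ) {β : ℝ} (hβ : 0 < β) :
    Integrable fun a : LandauFree H → E3 => cubicVertex β H a ^ 2 * gaussWeight β H a := by
  set BV : ℝ := 4 * |β| * (Literature.MathematicalPhysics.QuantumLattice.plaquettesTouching
        (Literature.MathematicalPhysics.QuantumFieldTheory.AxialGauge.boxEdges 4 (2 * H + 1))).card
  exact Tilt.integrable_bdd_mul_gaussWeight H hβ (C := BV ^ 2) ((measurable_cubicVertex β H).pow_const 2) fun a => by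
    rw [abs_pow]; exact pow_le_pow_left₀ (abs_nonneg _) (k4_abs_cubicVertex_le β H a) 2

/-- `1_D·(W + V₃ − b)²·gaussWeight` is integrable for a measurable `W` with `|W| ≤ B` everywhere (`β > 0`). -/
theorem integrable_sfInd_mul_sq_add_cubicVertex (H : ℕ) {β : ℝ} (hβ : 0 < β) (s : ℝ) {W : (LandauFree H → E3) → ℝ} {B : ℝ}
    (hWm : Measurable W) (hWb : ∀ a, |W a| ≤ B) (b : ℝ) :
    Integrable fun a : LandauFree H → E3 => sfInd H s a * (W a + cubicVertex β H a - b) ^ 2 * gaussWeight β H a := by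
  have hsf := fun a : LandauFree H → E3 => TiltSup.sfInd_nonneg_le_one (H := H) s a
  have hmeas : Measurable fun a => sfInd H s a * (W a + cubicVertex β H a - b) ^ 2 :=
    (Tilt.measurable_sfInd H s).mul (((hWm.add (measurable_cubicVertex β H)).sub measurable_const).pow_const 2)
  have IV := k4_integrable_cubicVertex_sq H hβ
  have hdom : Integrable fun a : LandauFree H → E3 => (2 * (B + |b|) ^ 2 + 2 * cubicVertex β H a ^ 2) * gaussWeight β H a := by
    have := ((EdgeChartGaussian.integrable_gaussWeight H hβ).const_mul (2 * (B + |b|) ^ 2)).add (IV.const_mul 2)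
    exact this.congr (Filter.Eventually.of_forall fun a => by simp only [Pi.add_apply]; ring)
  refine EdgeChartGaussian.integrable_mul_gaussWeight_of_abs_le H hβ hmeas hdom fun a => ?_
  rw [abs_mul, abs_of_nonneg (hsf a).1, abs_pow, sq_abs]
  have h1 : (W a - b) ^ 2 ≤ (B + |b|) ^ 2 := by
    have := sq_sub_le_sq_add_abs (hWb a) b
    rwa [abs_pow, sq_abs] at this
  have h2 := sq_add_sub_le_two (W a) (cubicVertex β H a) b
  have h3 : (W a + cubicVertex β H a - b) ^ 2 ≤ 2 * (B + |b|) ^ 2 + 2 * cubicVertex β H a ^ 2 := by linarith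
  calc sfInd H s a * (W a + cubicVertex β H a - b) ^ 2 ≤ 1 * (2 * (B + |b|) ^ 2 + 2 * cubicVertex β H a ^ 2) :=
        mul_le_mul (hsf a).2 h3 (sq_nonneg _) zero_le_one
    _ = _ := one_mul _

/-- **The `U`-slot**: `E₀[1_D·(Ũ − b)²] ≤ 2·E₀[V₃²] + 2·E₀[1_D·(tiltU + V₃ − b)²]` for the truncation `Ũ = 1_D·tiltU`
(pointwise `1_D(Ũ−b)² ≤ 2V₃² + 2·1_D(tiltU+V₃−b)²`; `|tiltU| ≤ B` on `D` makes everything integrable). -/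
theorem gaussAvg_sfInd_mul_sq_indicator_sub_le (H : ℕ) {β : ℝ} (hβ : 0 < β) (s : ℝ) {B : ℝ} (hB : 0 ≤ B)
    (hUb : ∀ a ∈ smallField H s, |tiltU β H a| ≤ B) (b : ℝ) :
    gaussAvg β H (fun a => sfInd H s a * ((smallField H s).indicator (tiltU β H) a - b) ^ 2) ≤
      2 * gaussAvg β H (fun a => cubicVertex β H a ^ 2) +
        2 * gaussAvg β H (fun a => sfInd H s a * (tiltU β H a + cubicVertex β H a - b) ^ 2) := by
  have hsf := fun a : LandauFree H → E3 => TiltSup.sfInd_nonneg_le_one (H := H) s a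
  have hmU : Measurable ((smallField H s).indicator (tiltU β H)) := (measurable_tiltU β H).indicator (ChartGauss.measurableSet_smallField s)
  have hUt : ∀ a, |(smallField H s).indicator (tiltU β H) a| ≤ B := fun a => Tilt.abs_indicator_le hB hUb a
  have IV := k4_integrable_cubicVertex_sq H hβ
  have IW' := integrable_sfInd_mul_sq_add_cubicVertex H hβ s hmU hUt b
  have IW : Integrable fun a : LandauFree H → E3 => sfInd H s a * (tiltU β H a + cubicVertex β H a - b) ^ 2 * gaussWeight β H a := by
    refine IW'.congr (Filter.Eventually.of_forall fun a => ?_)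
    show sfInd H s a * ((smallField H s).indicator (tiltU β H) a + cubicVertex β H a - b) ^ 2 * gaussWeight β H a =
      sfInd H s a * (tiltU β H a + cubicVertex β H a - b) ^ 2 * gaussWeight β H a
    rw [sfInd_mul_indicator_eq β s (fun u => (u + cubicVertex β H a - b) ^ 2) a]
  have hdom : ∀ a, sfInd H s a * ((smallField H s).indicator (tiltU β H) a - b) ^ 2 ≤
      2 * cubicVertex β H a ^ 2 + 2 * (sfInd H s a * (tiltU β H a + cubicVertex β H a - b) ^ 2) := by
    intro a
    by_cases ha : a ∈ smallField H s
    · have h1 : sfInd H s a = 1 := by rw [sfInd, Set.indicator_of_mem ha]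
      rw [h1, Set.indicator_of_mem ha, one_mul, one_mul]
      exact sq_sub_le_two _ _ _
    · have h1 : sfInd H s a = 0 := by rw [sfInd, Set.indicator_of_notMem ha]
      rw [h1, zero_mul, zero_mul, mul_zero, add_zero]
      positivity
  have I2V : Integrable fun a : LandauFree H → E3 => 2 * cubicVertex β H a ^ 2 * gaussWeight β H a := by
    have := IV.const_mul 2; exact this.congr (Filter.Eventually.of_forall fun a => by ring)
  have I2W : Integrable fun a : LandauFree H → E3 => 2 * (sfInd H s a * (tiltU β H a + cubicVertex β H a - b) ^ 2) * gaussWeight β H a := by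
    have := IW.const_mul 2; exact this.congr (Filter.Eventually.of_forall fun a => by ring)
  have hIsum : Integrable fun a : LandauFree H → E3 =>
      (2 * cubicVertex β H a ^ 2 + 2 * (sfInd H s a * (tiltU β H a + cubicVertex β H a - b) ^ 2)) * gaussWeight β H a := by
    have := I2V.add I2W
    exact this.congr (Filter.Eventually.of_forall fun a => by simp only [Pi.add_apply]; ring)
  have hmono := EdgeChartGaussian.gaussAvg_mono_of_nonneg H hβ (fun a => mul_nonneg (hsf a).1 (sq_nonneg _)) hdom hIsum
  rw [EdgeChartGaussian.gaussAvg_add β H I2V I2W, EdgeChartGaussian.gaussAvg_const_mul, EdgeChartGaussian.gaussAvg_const_mul] at hmono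
  exact hmono

/-! ## Combining two `C·L^m` bounds -/

/-- Combining two `C·L^m`-shaped bounds: `C₁L^{m₁}(A + B + q·(C₂L^{m₂}S)) ≤ C₁(1+C₂)L^{m₁+m₂}(A + B + q·S)` for `L ≥ 1` and nonnegative data. -/
theorem k4_combine {C₁ C₂ L A B q S : ℝ} {m₁ m₂ : ℕ} (hC₁ : 0 ≤ C₁) (hC₂ : 0 ≤ C₂) (hL : 1 ≤ L) (hA : 0 ≤ A) (hB : 0 ≤ B)
    (hq : 0 ≤ q) (hS : 0 ≤ S) :
    C₁ * L ^ m₁ * (A + B + q * (C₂ * L ^ m₂ * S)) ≤ C₁ * (1 + C₂) * L ^ (m₁ + m₂) * (A + B + q * S) := by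
  have hLm : L ^ m₁ ≤ L ^ (m₁ + m₂) := pow_le_pow_right₀ hL (by omega)
  have hL0 : 0 ≤ L ^ (m₁ + m₂) := le_trans (pow_nonneg (zero_le_one.trans hL) m₁) hLm
  have e : C₁ * L ^ m₁ * (A + B + q * (C₂ * L ^ m₂ * S)) = C₁ * L ^ m₁ * (A + B) + C₁ * C₂ * L ^ (m₁ + m₂) * (q * S) := by
    rw [pow_add]; ring
  have h1 : 0 ≤ C₁ * (L ^ (m₁ + m₂) - L ^ m₁) * (A + B) := mul_nonneg (mul_nonneg hC₁ (sub_nonneg.2 hLm)) (add_nonneg hA hB)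
  have h2 : 0 ≤ C₁ * L ^ (m₁ + m₂) * (q * S) := mul_nonneg (mul_nonneg hC₁ hL0) (mul_nonneg hq hS)
  have h3 : 0 ≤ C₁ * C₂ * L ^ (m₁ + m₂) * (A + B) := mul_nonneg (mul_nonneg (mul_nonneg hC₁ hC₂) hL0) (add_nonneg hA hB)
  rw [e]
  linarith


end GaussNormalForm

end Summit.QuantumFields.YangMills.Theorems.AllWindowsColdBoxBoxHighLine

end
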